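import Literature.NumberTheory.EllipticCurves.KubertTateSevenVeluIsogeny
import Literature.NumberTheory.EllipticCurves.ConstantKernelIsogenySelmerTrivial
import Literature.NumberTheory.GaloisRepresentations.HeckeCharacterProofs
import HarnessLib

/-!
# `Sel^φ(E_{m,n}/ℚ) = 0` for the Kubert–Tate `7`-torsion family in the tame régime (class-wide)

PROOF-ONLY file (theorems only), topic `NumberTheory/EllipticCurves`; the `7`-torsion sibling of
`KubertTateFiveSelmerTame`. For `m, n ∈ ℤ` with
`E_{m,n} = kubertTateSeven m n = [n² + mn - m², m²n(n-m), m²n³(n-m), 0, 0]` elliptic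
(`Δ = m⁷n⁷(m-n)⁷(m³ - 8m²n + 5mn² + n³) ≠ 0`) and Vélu's `7`-isogeny
`φ = sevenIsogeny m n : E_{m,n} → E'_{m,n} = E_{m,n}/⟨(0,0)⟩` of `KubertTateSevenVeluIsogeny` (kernel
the constant group `ℤ/7` of integral points `O, ±T, ±2T, ±3T`), Mazur's étale-kernel descent (tree
`ConstantKernelDescent.selmerGroup_eq_bot`: tame inertia kills an unramified-or-tame `ℤ/n`-valued
character at every place, then Minkowski) gives:

**Theorem** (`selmerGroup_sevenIsogeny_eq_bot`). *If `7 ∤ Δ(E_{m,n})` and no prime `p ≡ 1 (mod 7)`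
divides `Δ(E_{m,n})`, then `Sel^φ(E_{m,n}/ℚ) = 0`; hence `E'_{m,n}(ℚ) = φ(E_{m,n}(ℚ))`
(`exists_toGeomPoints_eq`) and `Ш(E_{m,n}/ℚ)[φ] = 0` (`ker_shaMap_sevenIsogeny_eq_bot`).*

This is the `ℤ/7`-side of the `7`-descent on the curves with a rational point of order `7`
(T. Fisher, JEMS 3 (2001), §§1–2, computes `Sel^φ` and `Sel^{φ̂}` for this family in general by
class-field theory; the régime here is the one in which `Sel^φ` vanishes for the elementary reason
above). `selmerGroup_sevenIsogeny_eq_bot_1_2` is the instance `(m, n) = (1, 2)` (the curve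
`[5, 2, 8, 0, 0]` of conductor `26`, `Δ = -2⁷·13`).

## References

* [Mazur1977] B. Mazur, *Modular curves and the Eisenstein ideal*, Ch. III §3 Thm. (3.1), Ch. I §1(g).
* [Fisher2001FiveSevenDescent] T. Fisher, *Some examples of 5 and 7 descent for elliptic curves
  over ℚ*, JEMS 3 (2001) 169–201, §§1–2.
* [Kubert1976] D. S. Kubert, *Universal bounds on the torsion of elliptic curves*, Table 3 (N = 7).
* [SilvermanAEC2009] J. H. Silverman, *AEC*, 2nd ed., Thm. X.4.2.
-/

noncomputable section

open scoped Classical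
open Polynomial WeierstrassCurve NumberField IsDedekindDomain Field
open Literature.NumberTheory.EllipticCurves Literature.NumberTheory.GaloisRepresentations

namespace Literature.NumberTheory.EllipticCurves

namespace KubertTateSevenVelu

/-! ### Over `ℚ` with integer parameters: the étale/tame régime -/

section Rat

/-- Two affine points with equal coordinates are equal (proof-irrelevant form). [folklore] -/
private theorem some_eq_some_of_eq' {R : Type*} [CommRing R] {V : WeierstrassCurve R}
    {x y x' y' : R} (hx : x = x') (hy : y = y') (h : V.toAffine.Nonsingular x y)
    (h' : V.toAffine.Nonsingular x' y') : Affine.Point.some x y h = Affine.Point.some x' y' h' := by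
  subst hx hy; rfl

variable (m n : ℤ) [hE : (kubertTateSeven (m : ℚ) (n : ℚ)).IsElliptic]

omit hE in
/-- The integer model. [cite: Kubert1976, Table 3 (N = 7)] -/
theorem eq_map_int : kubertTateSeven (m : ℚ) (n : ℚ) = (kubertTateSeven m n).map (Int.castRingHom ℚ) := by
  rw [map_kubertTateSeven]; rfl

/-- **The kernel points are integral**: a non-zero `P ∈ ker φ` is `(a, b)` with `(a, b)` one of the
six integral points `(0,0), (0, m²n³(m-n)), (m²n(m-n), 0), (m²n(m-n), m³n(m-n)²), (mn²(m-n), mn³(m-n)²),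
(mn²(m-n), m²n²(m-n)²)`. [cite: Velu1971, formulae] -/
theorem exists_int_of_mem_ker (P : geomPoints (kubertTateSeven (m : ℚ) (n : ℚ)))
    (hP : P ∈ (sevenIsogeny (m : ℚ) (n : ℚ)).toAddMonoidHom.ker) (hP0 : P ≠ 0) :
    ∃ (a b : ℤ) (h : ((kubertTateSeven (m : ℚ) (n : ℚ)).baseChange (AlgebraicClosure ℚ)).toAffine.Nonsingular
      (a : AlgebraicClosure ℚ) (b : AlgebraicClosure ℚ)), P = Affine.Point.some _ _ h := by
  have hP' : sevenIsogeny (m : ℚ) (n : ℚ) P = 0 := hP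
  have cast : ∀ z : ℤ, algebraMap ℚ (AlgebraicClosure ℚ) (z : ℚ) = ((z : ℤ) : AlgebraicClosure ℚ) :=
    fun z ↦ by rw [map_intCast]
  have c0 : ((0 : ℤ) : AlgebraicClosure ℚ) = 0 := Int.cast_zero
  have c1 : (((m ^ 2 * n ^ 3 * (m - n) : ℤ)) : AlgebraicClosure ℚ) =
      algebraMap ℚ (AlgebraicClosure ℚ) ((m : ℚ) ^ 2 * (n : ℚ) ^ 3 * ((m : ℚ) - (n : ℚ))) := by
    rw [← cast]; push_cast; rfl
  have c2 : (((m ^ 2 * n * (m - n) : ℤ)) : AlgebraicClosure ℚ) =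
      algebraMap ℚ (AlgebraicClosure ℚ) ((m : ℚ) ^ 2 * (n : ℚ) * ((m : ℚ) - (n : ℚ))) := by
    rw [← cast]; push_cast; rfl
  have c3 : (((m ^ 3 * n * (m - n) ^ 2 : ℤ)) : AlgebraicClosure ℚ) =
      algebraMap ℚ (AlgebraicClosure ℚ) ((m : ℚ) ^ 3 * (n : ℚ) * ((m : ℚ) - (n : ℚ)) ^ 2) := by
    rw [← cast]; push_cast; rfl
  have c4 : (((m * n ^ 2 * (m - n) : ℤ)) : AlgebraicClosure ℚ) =
      algebraMap ℚ (AlgebraicClosure ℚ) ((m : ℚ) * (n : ℚ) ^ 2 * ((m : ℚ) - (n : ℚ))) := by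
    rw [← cast]; push_cast; rfl
  have c5 : (((m * n ^ 3 * (m - n) ^ 2 : ℤ)) : AlgebraicClosure ℚ) =
      algebraMap ℚ (AlgebraicClosure ℚ) ((m : ℚ) * (n : ℚ) ^ 3 * ((m : ℚ) - (n : ℚ)) ^ 2) := by
    rw [← cast]; push_cast; rfl
  have c6 : (((m ^ 2 * n ^ 2 * (m - n) ^ 2 : ℤ)) : AlgebraicClosure ℚ) =
      algebraMap ℚ (AlgebraicClosure ℚ) ((m : ℚ) ^ 2 * (n : ℚ) ^ 2 * ((m : ℚ) - (n : ℚ)) ^ 2) := by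
    rw [← cast]; push_cast; rfl
  rcases mem_ker_sevenIsogeny_imp (m : ℚ) (n : ℚ) hP' with rfl | ⟨x, y, h, rfl, hxy⟩
  · exact absurd rfl hP0
  rcases hxy with ⟨hx, hy | hy⟩ | ⟨hx, hy | hy⟩ | ⟨hx, hy | hy⟩ <;> subst hx <;> subst hy
  · exact ⟨0, 0, by rw [c0]; exact h, some_eq_some_of_eq' c0.symm c0.symm _ _⟩
  · exact ⟨0, m ^ 2 * n ^ 3 * (m - n), by rw [c0, c1]; exact h, some_eq_some_of_eq' c0.symm c1.symm _ _⟩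
  · exact ⟨m ^ 2 * n * (m - n), 0, by rw [c0, c2]; exact h, some_eq_some_of_eq' c2.symm c0.symm _ _⟩
  · exact ⟨m ^ 2 * n * (m - n), m ^ 3 * n * (m - n) ^ 2, by rw [c2, c3]; exact h,
      some_eq_some_of_eq' c2.symm c3.symm _ _⟩
  · exact ⟨m * n ^ 2 * (m - n), m * n ^ 3 * (m - n) ^ 2, by rw [c4, c5]; exact h,
      some_eq_some_of_eq' c4.symm c5.symm _ _⟩
  · exact ⟨m * n ^ 2 * (m - n), m ^ 2 * n ^ 2 * (m - n) ^ 2, by rw [c4, c6]; exact h,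
      some_eq_some_of_eq' c4.symm c6.symm _ _⟩

omit hE in
/-- **The étale/tame hypothesis place by place**, from `7 ∤ Δ` and "no bad prime is `≡ 1 (mod 7)`":
every finite place `v` of `ℚ` has `Δ(E_{m,n}) ∉ v`, or `7 ∉ v` and `gcd(7, N v - 1) = 1`.
[cite: Mazur1977, Ch. I §1(g)] -/
theorem etale_or_tame (h7 : ¬ (7 : ℤ) ∣ (kubertTateSeven m n).Δ)
    (h1 : ∀ p : ℕ, p.Prime → (p : ℤ) ∣ (kubertTateSeven m n).Δ → p % 7 ≠ 1)
    (v : HeightOneSpectrum (𝓞 ℚ)) :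
    (((kubertTateSeven m n).Δ : ℤ) : 𝓞 ℚ) ∉ v.asIdeal ∨
      (((7 : ℕ) : 𝓞 ℚ) ∉ v.asIdeal ∧ Nat.Coprime 7 (v.residueCard - 1)) := by
  have h7p : Nat.Prime 7 := by norm_num
  set p := Rat.HeightOneSpectrum.natGenerator v with hp
  have hpp : p.Prime := Rat.HeightOneSpectrum.prime_natGenerator v
  by_cases hdvd : (p : ℤ) ∣ (kubertTateSeven m n).Δ
  · right
    have hres : v.residueCard = p := Rat.residueCard_eq_natGenerator v
    rw [Rat.natCast_mem_asIdeal_iff, hres, ← hp]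
    have hp7 : p ≠ 7 := by
      rintro h77; rw [h77] at hdvd; exact h7 (by exact_mod_cast hdvd)
    refine ⟨fun h ↦ hp7 ((Nat.prime_dvd_prime_iff_eq hpp h7p).mp h), ?_⟩
    have hmod := h1 p hpp hdvd
    -- `gcd(7, p - 1) = 1` unless `7 ∣ p - 1`, i.e. `p ≡ 1 (mod 7)`
    rw [Nat.Prime.coprime_iff_not_dvd h7p]
    intro h
    have := hpp.two_le
    omega
  · left
    rwa [Rat.intCast_mem_asIdeal_iff, ← hp]

/-! ### Conclusions (class-wide): `Sel^φ = 0`, `E'(ℚ) = φ(E(ℚ))`, `Ш[φ] = 0` -/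

/-- **`Sel^φ(E_{m,n}/ℚ) = 0` in the tame régime** (`m, n ∈ ℤ`, `E_{m,n}` elliptic, `7 ∤ Δ(E_{m,n})`,
and no prime `p ≡ 1 (mod 7)` divides `Δ(E_{m,n}) = m⁷n⁷(m-n)⁷(m³ - 8m²n + 5mn² + n³)`): the
`ℤ/7`-side of the `7`-descent via `φ : E_{m,n} → E_{m,n}/⟨(0,0)⟩` is empty, by Mazur's étale-kernel
descent (`ConstantKernelDescent.selmerGroup_eq_bot`: kernel constant and integral, every place étale
or tame, Minkowski).
[cite: Mazur1977, Ch. III §3 Thm. (3.1) with Ch. I §1(g); Fisher2001FiveSevenDescent, §§1–2] -/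
theorem selmerGroup_sevenIsogeny_eq_bot (h7 : ¬ (7 : ℤ) ∣ (kubertTateSeven m n).Δ)
    (h1 : ∀ p : ℕ, p.Prime → (p : ℤ) ∣ (kubertTateSeven m n).Δ → p % 7 ≠ 1) :
    (sevenIsogeny (m : ℚ) (n : ℚ)).selmerGroup = ⊥ :=
  ConstantKernelDescent.selmerGroup_eq_bot (sevenIsogeny (m : ℚ) (n : ℚ)) (kubertTateSeven m n)
    (eq_map_int m n) (fun σ P hP ↦ smul_eq_of_mem_ker (m : ℚ) (n : ℚ) σ P hP)
    (exists_int_of_mem_ker m n) (n := 7) (by norm_num)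
    (fun P hP ↦ seven_nsmul_eq_zero_of_mem_ker (m : ℚ) (n : ℚ) hP) (etale_or_tame m n h7 h1)

/-- **`E'_{m,n}(ℚ) = φ(E_{m,n}(ℚ))` in the tame régime**: every rational point of the isogenous
curve is the image of a rational point. [cite: SilvermanAEC2009, Thm. X.4.2(a)] -/
theorem exists_toGeomPoints_eq (h7 : ¬ (7 : ℤ) ∣ (kubertTateSeven m n).Δ)
    (h1 : ∀ p : ℕ, p.Prime → (p : ℤ) ∣ (kubertTateSeven m n).Δ → p % 7 ≠ 1)
    (P' : (kubertTateSeven' (m : ℚ) (n : ℚ)).toAffine.Point) :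
    ∃ P : (kubertTateSeven (m : ℚ) (n : ℚ)).toAffine.Point,
      (kubertTateSeven' (m : ℚ) (n : ℚ)).toGeomPoints P' =
        sevenIsogeny (m : ℚ) (n : ℚ) ((kubertTateSeven (m : ℚ) (n : ℚ)).toGeomPoints P) :=
  ConstantKernelDescent.exists_toGeomPoints_eq_of_selmerGroup_eq_bot (sevenIsogeny (m : ℚ) (n : ℚ))
    (selmerGroup_sevenIsogeny_eq_bot m n h7 h1) P'

/-- **`Ш(E_{m,n}/ℚ)[φ] = 0` in the tame régime**: the kernel of `Ш(φ) : Ш(E_{m,n}/ℚ) → Ш(E'_{m,n}/ℚ)`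
is trivial. [cite: SilvermanAEC2009, Thm. X.4.2(a)] -/
theorem ker_shaMap_sevenIsogeny_eq_bot (h7 : ¬ (7 : ℤ) ∣ (kubertTateSeven m n).Δ)
    (h1 : ∀ p : ℕ, p.Prime → (p : ℤ) ∣ (kubertTateSeven m n).Δ → p % 7 ≠ 1) :
    (shaMap (sevenIsogeny (m : ℚ) (n : ℚ)).toAddMonoidHom (sevenIsogeny (m : ℚ) (n : ℚ)).equivariant
      (sevenIsogeny (m : ℚ) (n : ℚ)).hasLocalPointsMaps_toAddMonoidHom).ker = ⊥ :=
  ConstantKernelDescent.ker_shaMap_eq_bot_of_selmerGroup_eq_bot (sevenIsogeny (m : ℚ) (n : ℚ))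
    (selmerGroup_sevenIsogeny_eq_bot m n h7 h1)

/-- Elementwise form: in the tame régime a class of `Ш(E_{m,n}/ℚ)` killed by `Ш(φ)` is zero.
[cite: SilvermanAEC2009, Thm. X.4.2(a)] -/
theorem eq_zero_of_shaMap_sevenIsogeny_eq_zero (h7 : ¬ (7 : ℤ) ∣ (kubertTateSeven m n).Δ)
    (h1 : ∀ p : ℕ, p.Prime → (p : ℤ) ∣ (kubertTateSeven m n).Δ → p % 7 ≠ 1)
    {c : (kubertTateSeven (m : ℚ) (n : ℚ)).sha}
    (hc : shaMap (sevenIsogeny (m : ℚ) (n : ℚ)).toAddMonoidHom (sevenIsogeny (m : ℚ) (n : ℚ)).equivariant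
      (sevenIsogeny (m : ℚ) (n : ℚ)).hasLocalPointsMaps_toAddMonoidHom c = 0) : c = 0 := by
  have hmem := (AddMonoidHom.mem_ker).mpr hc
  rw [ker_shaMap_sevenIsogeny_eq_bot m n h7 h1] at hmem
  exact (AddSubgroup.mem_bot).mp hmem

end Rat

/-! ### The instance `(m, n) = (1, 2)`: the curve `[5, 2, 8, 0, 0]` of conductor `26` -/

section Instance12

/-- `E_{1,2} = [5, 2, 8, 0, 0]` is elliptic: `Δ = -1664 = -2⁷·13 ≠ 0`. [cite: Kubert1976, Table 3 (N = 7)] -/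
theorem isElliptic_1_2 : (kubertTateSeven ((1 : ℤ) : ℚ) ((2 : ℤ) : ℚ)).IsElliptic := by
  refine ⟨isUnit_iff_ne_zero.mpr ?_⟩
  rw [eq_map_int 1 2, map_Δ, kubertTateSeven_Δ]
  norm_num

/-- **The instance `(m, n) = (1, 2)`** (`E_{1,2} = [5, 2, 8, 0, 0]`, conductor `26`, `Δ = -2⁷·13`):
the hypotheses of the class-wide theorem hold (`7 ∤ Δ`; the bad primes `2, 13` are `≢ 1 (mod 7)`),
so `Sel^φ(E_{1,2}/ℚ) = 0`. [cite: Fisher2001FiveSevenDescent, §§1–2] -/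
theorem selmerGroup_sevenIsogeny_eq_bot_1_2 :
    haveI := isElliptic_1_2
    (sevenIsogeny ((1 : ℤ) : ℚ) ((2 : ℤ) : ℚ)).selmerGroup = ⊥ := by
  haveI := isElliptic_1_2
  refine selmerGroup_sevenIsogeny_eq_bot 1 2 (by rw [kubertTateSeven_Δ]; norm_num) ?_
  intro p hp hdvd
  rw [kubertTateSeven_Δ] at hdvd
  norm_num at hdvd
  -- `Δ = -1664 = -(2⁷·13)`
  have hdvdN : p ∣ 2 ^ 7 * 13 := by
    have h' : (p : ℤ) ∣ ((2 ^ 7 * 13 : ℕ) : ℤ) := by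
      have e : ((2 ^ 7 * 13 : ℕ) : ℤ) = 1664 := by norm_num
      rw [e]
      exact (Int.dvd_neg).mp (by simpa using hdvd)
    exact Int.natCast_dvd_natCast.mp h'
  have hpi := Nat.Prime.prime hp
  rcases hpi.dvd_or_dvd hdvdN with h | h
  · have := (Nat.prime_dvd_prime_iff_eq hp Nat.prime_two).mp (hpi.dvd_of_dvd_pow h); omega
  · have := (Nat.prime_dvd_prime_iff_eq hp (by norm_num)).mp h; omega

end Instance12

end KubertTateSevenVelu

end Literature.NumberTheory.EllipticCurves

end
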